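import Mathlib
import Summits.Ventures.FusionMHD.Models.CerfonFreidbergIterLikeQHalfLevel
import Summits.Ventures.FusionMHD.Models.FluxSurfacePolarRayLevelVolume
import HarnessLib

/-!
# Ventures/FusionMHD — Models/CerfonFreidbergIterLikeQHalfVolume.lean: on THE Cerfon–Freidberg ITER-like flux, the volume enclosed by
# the surfaces `U = u` near `ψ_N = 1/2` is differentiable in the level and ITS DERIVATIVE IS Freidberg's `dV/dψ = 2π∮dℓ/B_p` (6.22)

HONEST FRAMING (LADDER-GRIDFUSION three columns; CF rung, F2 item R2; «F2.R2-POLAR-LEVEL-DERIV» instance corollary, LOW, no count).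
* CERTIFIED (kernel; this file + imports, axioms standard): for `U = cfSolution 0 coeff`, axis `(X_a, 0)`, level `u₀ = U(X_a,0)/2`:
  `HasDerivAt (PolarRay.torVolume U X_a 0) (GradShafranov.volumeDerivE U (PolarRay.loop X_a 0 ρ) (2π)) u₀` — the enclosed volume of
  the glued star-shaped surfaces `U = u` (polar chart, `Models/FluxSurfacePolarRayLevelVolume.lean`) has, at `ψ_N = 1/2`, the
  derivative `2π∮ dℓ/B_p` over the certified loop of ★ #117 (`…QHalfLevel.levelLoop` + `LevelLoop.hasDerivAt_torVolume`); and the same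
  derivative as the polar integral `2π∫₀^{2π} volKernel X_a Dfield θ (ρ θ) dθ`.  No numerical value is claimed.
* VALIDATED: nothing used.  MODELLED: analytic CF family; the polar-chart volume formula; nothing about a device or stability.
Typer/prover: gridfusion-model-7 (g5), 2026-08-27.  Citations: Freidberg 2014 §6.3.2 (6.22) [Freidberg2014]; Jardin 2010 §5.3 (5.29) [Jardin2010].
-/

noncomputable section

open Set
open Literature.MathematicalPhysics.MHD Literature.MathematicalPhysics.MHD.GradShafranov
open Summit.Ventures.FusionMHD.Models.PolarRay

namespace Summit.Ventures.FusionMHD.Models.CFIterLike.QHalf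

/-- **`dV/du` AT `ψ_N = 1/2` IS `2π∮ dℓ/B_p`** over the certified loop: `HasDerivAt (torVolume U X_a 0) (volumeDerivE U (loop X_a 0 ρ) (2π)) u₀`.
[cite: Freidberg2014, §6.3.2 eq. (6.22)] -/
theorem hasDerivAt_torVolume_half :
    HasDerivAt (torVolume U Xa 0) (volumeDerivE U (loop Xa 0 ρ) (2 * Real.pi)) u₀ := by
  rw [show loop Xa 0 ρ = loop Xa 0 (rayRadius U Xa 0 u₀) from rfl]
  exact levelLoop.hasDerivAt_torVolume box_facts.1 box_facts.2 u₀_mem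

/-- … and as the polar integral: `HasDerivAt (torVolume U X_a 0) (2π ∫₀^{2π} volKernel X_a Dfield θ (ρ θ) dθ) u₀`.
[cite: Jardin2010, §5.3 eq. (5.29)] -/
theorem hasDerivAt_torVolume_half_polar :
    HasDerivAt (torVolume U Xa 0) (2 * Real.pi * ∫ θ in (0 : ℝ)..(2 * Real.pi), volKernel Xa Dfield θ (ρ θ)) u₀ :=
  levelLoop.hasDerivAt_torVolume_polar u₀_mem

/-- Consistency: the two derivative expressions agree, `volumeDerivE U (loop X_a 0 ρ) (2π) = 2π ∫₀^{2π} volKernel X_a Dfield θ (ρ θ) dθ`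
(also `volumeDerivE_eq_near` at `u₀`). [cite: Freidberg2014, §6.3.2 eq. (6.22)] -/
theorem volumeDerivE_half_eq_polar :
    volumeDerivE U (loop Xa 0 ρ) (2 * Real.pi) = 2 * Real.pi * ∫ θ in (0 : ℝ)..(2 * Real.pi), volKernel Xa Dfield θ (ρ θ) :=
  hasDerivAt_torVolume_half.unique hasDerivAt_torVolume_half_polar

end Summit.Ventures.FusionMHD.Models.CFIterLike.QHalf

end
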